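import Summits.Schanuel.Schanuel.Theorems.SoloInformedX193Factors
import Summits.Schanuel.Schanuel.Theorems.SoloInformedRoyAdditiveGelfond

/-!
# X193 kernel, layer B (F9b-2): the budget and service laws for `soloX_pieces`

Soloist file (`solo-Schanuel-informed`, s227, 2026-09-01); DESIGN
`work/s213/X193-KERNEL-DESIGN.md`, Amendment A12 (iii) (with `b₁ = 2`, A13).  No new
definitions.

Let `R : ℕ → ℤ[X]` be Roy data of order `τ = 0` from level `n₀` on,
`R n ∈ RoyAdditiveSmall ξ β σ 0 ν n` for `n ≥ n₀` (`R n ≠ 0`, `deg R n ≤ n`,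
`H(R n) ≤ exp (n ^ β)`, `‖R n (k ξ)‖ ≤ exp (-n ^ ν)` for naturals `k ≤ n ^ σ`).  Then the
instance `soloX_pieces ξ R` of F8 satisfies

* (Bud) `soloX_pieces_budgetLaw`: `soloX_pieces ξ R ∈ budgetLaw β 2 n₀` — the degree half is
  F9b-1; the height half is Mahler's inequality `log ‖P‖ ≤ deg P + log M(P)` for the pieces,
  multiplicativity of the Mahler measure over the factorisation of `R n`, and Landau's
  inequality `log M(R n) ≤ deg R n + log ‖R n‖ ≤ n + n ^ β`;
* (Srv) `soloX_pieces_serviceLaw` (for `ξ` transcendental):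
  `soloX_pieces ξ R ∈ serviceLaw σ ν c₀ n₀` with `c₀ = max 0 (log 2 - log ‖ξ‖)` — evaluate the
  factorisation of `R n` at `k ξ` (`R n (k ξ) ≠ 0` by transcendence): the pieces carry
  `-log ‖R n (kξ)‖ ≥ n ^ ν` up to the non-pieces, of which the constants only help and `X`
  costs at most `(count X) · (-log ‖ξ‖)⁺ ≤ c₀ n`.

Tree inputs: `Polynomial.log_supNorm_le`, `Polynomial.logMahlerMeasure_map_le`
(`Literature/NumberTheory/Transcendental/GelfondCriterionProofs`),
`Polynomial.one_le_supNorm_of_ne_zero` (`GelfondCriterion`), `supNorm_le_polyHeight`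
(`SoloInformedRoyAdditiveGelfond`).
-/

namespace Summit.Schanuel.Schanuel.Theorems

open Polynomial UniqueFactorizationMonoid

/-! ## Unpacking `RoyAdditiveSmall` at order `τ = 0` -/

section small

variable {ξ : ℂ} {β σ ν : ℝ} {n : ℕ} {x : ℤ[X]}

/-- Roy data are nonzero. -/
theorem soloX_small_ne_zero (hx : x ∈ RoyAdditiveSmall ξ β σ 0 ν n) : x ≠ 0 :=
  hx.1

/-- Roy data at level `n` have degree `≤ n`. -/
theorem soloX_small_natDegree_le (hx : x ∈ RoyAdditiveSmall ξ β σ 0 ν n) :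
    (x.natDegree : ℝ) ≤ n := by
  exact_mod_cast hx.2.1

/-- Roy data at level `n` have `log ‖x‖_∞ ≤ n ^ β`. -/
theorem soloX_small_log_supNorm_le (hx : x ∈ RoyAdditiveSmall ξ β σ 0 ν n) :
    Real.log x.supNorm ≤ (n : ℝ) ^ β := by
  have h1 : 1 ≤ x.supNorm := Polynomial.one_le_supNorm_of_ne_zero hx.1
  rw [Real.log_le_iff_le_exp (by linarith)]
  exact (supNorm_le_polyHeight x).trans hx.2.2.1

/-- Roy data at level `n` are small at `k ξ` for every natural `k ≤ n ^ σ` (order `0`). -/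
theorem soloX_small_norm_aeval_le (hx : x ∈ RoyAdditiveSmall ξ β σ 0 ν n) {k : ℕ}
    (hk : (k : ℝ) ≤ (n : ℝ) ^ σ) :
    ‖aeval ((k : ℂ) * ξ) x‖ ≤ Real.exp (-(n : ℝ) ^ ν) := by
  have h := hx.2.2.2 k 0 hk (by rw [Nat.cast_zero, Real.rpow_zero]; exact zero_le_one)
  rwa [hasseDeriv_zero'] at h

end small

/-! ## Transcendence: `R n (k ξ) ≠ 0` -/

/-- A transcendental number is nonzero. -/
theorem soloX_ne_zero_of_transcendental {ξ : ℂ} (hξ : Transcendental ℚ ξ) : ξ ≠ 0 :=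
  fun h => hξ (h ▸ isAlgebraic_zero)

/-- `k ξ` is transcendental for `k ≥ 1` if `ξ` is. -/
theorem soloX_transcendental_nat_mul {ξ : ℂ} (hξ : Transcendental ℚ ξ) {k : ℕ} (hk : 1 ≤ k) :
    Transcendental ℚ ((k : ℂ) * ξ) := by
  have hk0 : (k : ℚ) ≠ 0 := by exact_mod_cast Nat.one_le_iff_ne_zero.mp hk
  have h := hξ.aeval (C (k : ℚ) * X) (by rw [natDegree_C_mul_X _ hk0]; exact one_ne_zero)
    (by rw [leadingCoeff_C_mul_X]; exact mem_nonZeroDivisors_of_ne_zero hk0)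
  rwa [map_mul, aeval_C, aeval_X, eq_ratCast, Rat.cast_natCast] at h

/-- A nonzero integer polynomial does not vanish at `k ξ`, `k ≥ 1`, `ξ` transcendental. -/
theorem soloX_aeval_ne_zero {ξ : ℂ} (hξ : Transcendental ℚ ξ) {k : ℕ} (hk : 1 ≤ k)
    {x : ℤ[X]} (hx : x ≠ 0) : aeval ((k : ℂ) * ξ) x ≠ 0 := by
  intro h
  apply soloX_transcendental_nat_mul hξ hk
  refine ⟨x.map (algebraMap ℤ ℚ), ?_, ?_⟩
  · exact (Polynomial.map_ne_zero_iff (algebraMap ℤ ℚ).injective_int).mpr hx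
  · rw [aeval_map_algebraMap]
    exact h

/-! ## (Bud) the budget law -/

/-- **(Bud)** For Roy data of order `0` from level `n₀` on, `soloX_pieces ξ R ∈ budgetLaw β 2 n₀`:
at every level `n ≥ n₀`, `∑ mult · deg ≤ n` and `∑ mult · log ‖P‖ ≤ n ^ β + 2 n`. -/
theorem soloX_pieces_budgetLaw {ξ : ℂ} {β σ ν : ℝ} {R : ℕ → ℤ[X]} {n₀ : ℕ}
    (hR : ∀ n, n₀ ≤ n → R n ∈ RoyAdditiveSmall ξ β σ 0 ν n) :
    soloX_pieces ξ R ∈ SoloServiceData.budgetLaw β 2 n₀ := by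
  intro n hn
  have hx := hR n hn
  have hx0 : R n ≠ 0 := hx.1
  have hdeg : ((R n).natDegree : ℝ) ≤ n := soloX_small_natDegree_le hx
  have hsumdeg := soloX_pieces_sum_mult_deg_le ξ R n hx0
  refine ⟨hsumdeg.trans hdeg, ?_⟩
  have hM : ∑ P ∈ (soloX_pieces ξ R).alive n, ((soloX_pieces ξ R).mult P n : ℝ) *
      Real.log ((P : ℤ[X]).map (Int.castRingHom ℂ)).mahlerMeasure ≤
        Real.log ((R n).map (Int.castRingHom ℂ)).mahlerMeasure := by
    rw [soloX_log_mahlerMeasure_eq_sum_factors hx0]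
    exact soloX_sum_alive_le_sum_factors ξ R n
      (fun m : ℤ[X] => Real.log (m.map (Int.castRingHom ℂ)).mahlerMeasure)
      (fun m hm _ => Real.log_nonneg (soloX_one_le_mahlerMeasure_factor hm))
  have hMR : Real.log ((R n).map (Int.castRingHom ℂ)).mahlerMeasure ≤
      (R n).natDegree + (n : ℝ) ^ β := by
    have h := Polynomial.logMahlerMeasure_map_le hx0
    rw [Polynomial.logMahlerMeasure_eq_log_MahlerMeasure] at h
    linarith [soloX_small_log_supNorm_le hx]
  have hpt : ∀ P ∈ (soloX_pieces ξ R).alive n,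
      ((soloX_pieces ξ R).mult P n : ℝ) * (soloX_pieces ξ R).logHt P ≤
        ((soloX_pieces ξ R).mult P n : ℝ) * (soloX_pieces ξ R).deg P +
        ((soloX_pieces ξ R).mult P n : ℝ) *
          Real.log ((P : ℤ[X]).map (Int.castRingHom ℂ)).mahlerMeasure := by
    intro P _
    rw [← mul_add, soloX_pieces_logHt, soloX_pieces_deg]
    refine mul_le_mul_of_nonneg_left ?_ (Nat.cast_nonneg _)
    have h := Polynomial.log_supNorm_le (soloX_piece_ne_zero P)
    rwa [Polynomial.logMahlerMeasure_eq_log_MahlerMeasure] at h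
  have h1 := Finset.sum_le_sum hpt
  rw [Finset.sum_add_distrib] at h1
  linarith

/-! ## (Srv) the service law -/

/-- The non-piece part of the value sum at `k ξ` (`k ≥ 1`, `ξ ≠ 0`) is
`≥ -(max 0 (log 2 - log ‖ξ‖)) · deg (R n)`: factors of degree `0` have values of norm `≥ 1`,
and `X` occurs `count X ≤ deg (R n)` times with value `log (k ‖ξ‖) ≥ log ‖ξ‖`. -/
theorem soloX_sum_nonpiece_log_norm_ge {ξ : ℂ} (hξ0 : ξ ≠ 0) (R : ℕ → ℤ[X]) {n : ℕ}
    (hR : R n ≠ 0) {k : ℕ} (hk : 1 ≤ k) :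
    -(max 0 (Real.log 2 - Real.log ‖ξ‖) * (R n).natDegree) ≤
      ∑ m ∈ (normalizedFactors (R n)).toFinset \
          ((soloX_pieces ξ R).alive n).map (Function.Embedding.subtype (· ∈ soloX_pieceSet)),
        ((normalizedFactors (R n)).count m : ℝ) * Real.log ‖aeval ((k : ℂ) * ξ) m‖ := by
  set c₀ := max 0 (Real.log 2 - Real.log ‖ξ‖) with hc₀
  have hc₀0 : 0 ≤ c₀ := le_max_left _ _
  have hlog : -c₀ ≤ Real.log ‖(k : ℂ) * ξ‖ := by
    have hξpos : 0 < ‖ξ‖ := norm_pos_iff.mpr hξ0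
    have hk1 : (1 : ℝ) ≤ k := by exact_mod_cast hk
    have h1 : Real.log ‖ξ‖ ≤ Real.log ‖(k : ℂ) * ξ‖ := by
      apply Real.log_le_log hξpos
      rw [norm_mul, Complex.norm_natCast]
      exact le_mul_of_one_le_left hξpos.le hk1
    have h2 : Real.log 2 - Real.log ‖ξ‖ ≤ c₀ := le_max_right _ _
    have h3 : 0 ≤ Real.log 2 := Real.log_nonneg (by norm_num)
    linarith
  have hcnt : ((normalizedFactors (R n)).count X : ℝ) ≤ (R n).natDegree := by
    exact_mod_cast soloX_count_X_le_natDegree hR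
  have hterm : ∀ m ∈ (normalizedFactors (R n)).toFinset \
      ((soloX_pieces ξ R).alive n).map (Function.Embedding.subtype (· ∈ soloX_pieceSet)),
      (if m = X then -(c₀ * (R n).natDegree) else (0 : ℝ)) ≤
        ((normalizedFactors (R n)).count m : ℝ) * Real.log ‖aeval ((k : ℂ) * ξ) m‖ := by
    intro m hm
    obtain ⟨hm1, hm2⟩ := (soloX_mem_sdiff_aliveMap_iff ξ R n m).mp hm
    rcases soloX_nonpiece_factor hm1 hm2 with h0 | hX
    · have hmX : m ≠ X := by
        rintro rfl
        rw [natDegree_X] at h0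
        exact one_ne_zero h0
      rw [if_neg hmX]
      exact mul_nonneg (Nat.cast_nonneg _) (Real.log_nonneg
        (soloX_one_le_norm_aeval_of_natDegree_eq_zero (soloX_factor_ne_zero hm1) h0 _))
    · subst hX
      rw [if_pos rfl, aeval_X]
      calc -(c₀ * (R n).natDegree) ≤ -(c₀ * (normalizedFactors (R n)).count X) :=
            neg_le_neg (mul_le_mul_of_nonneg_left hcnt hc₀0)
        _ = ((normalizedFactors (R n)).count X : ℝ) * (-c₀) := by ring
        _ ≤ ((normalizedFactors (R n)).count X : ℝ) * Real.log ‖(k : ℂ) * ξ‖ :=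
            mul_le_mul_of_nonneg_left hlog (Nat.cast_nonneg _)
  refine le_trans ?_ (Finset.sum_le_sum hterm)
  rw [Finset.sum_ite_eq']
  split_ifs
  · exact le_rfl
  · exact neg_nonpos.mpr (mul_nonneg hc₀0 (Nat.cast_nonneg _))

/-- **(Srv)** For `ξ` transcendental and Roy data of order `0` from level `n₀` on,
`soloX_pieces ξ R ∈ serviceLaw σ ν (max 0 (log 2 - log ‖ξ‖)) n₀`: at every level `n ≥ n₀` and
every column `1 ≤ k ≤ n ^ σ`, `∑ mult · bank ≥ n ^ ν - c₀ n`. -/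
theorem soloX_pieces_serviceLaw {ξ : ℂ} (hξ : Transcendental ℚ ξ) {β σ ν : ℝ}
    {R : ℕ → ℤ[X]} {n₀ : ℕ} (hR : ∀ n, n₀ ≤ n → R n ∈ RoyAdditiveSmall ξ β σ 0 ν n) :
    soloX_pieces ξ R ∈
      SoloServiceData.serviceLaw σ ν (max 0 (Real.log 2 - Real.log ‖ξ‖)) n₀ := by
  intro n hn k hk hkσ
  have hx := hR n hn
  have hx0 : R n ≠ 0 := hx.1
  have hξ0 : ξ ≠ 0 := soloX_ne_zero_of_transcendental hξ
  have hz : aeval ((k : ℂ) * ξ) (R n) ≠ 0 := soloX_aeval_ne_zero hξ hk hx0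
  have hval : Real.log ‖aeval ((k : ℂ) * ξ) (R n)‖ ≤ -(n : ℝ) ^ ν :=
    (Real.log_le_iff_le_exp (norm_pos_iff.mpr hz)).mpr (soloX_small_norm_aeval_le hx hkσ)
  have hsplit := soloX_sum_factors_split ξ R n (fun m => Real.log ‖aeval ((k : ℂ) * ξ) m‖)
  rw [← soloX_log_norm_aeval_eq_sum_factors hx0 hz] at hsplit
  have hnp := soloX_sum_nonpiece_log_norm_ge hξ0 R hx0 hk
  have hdeg : ((R n).natDegree : ℝ) ≤ n := soloX_small_natDegree_le hx
  have hc₀ : 0 ≤ max 0 (Real.log 2 - Real.log ‖ξ‖) := le_max_left _ _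
  have hbank : ∑ P ∈ (soloX_pieces ξ R).alive n,
      ((soloX_pieces ξ R).mult P n : ℝ) * (soloX_pieces ξ R).bank P k =
      -∑ P ∈ (soloX_pieces ξ R).alive n,
        ((soloX_pieces ξ R).mult P n : ℝ) * Real.log ‖aeval ((k : ℂ) * ξ) (P : ℤ[X])‖ := by
    rw [← Finset.sum_neg_distrib]
    refine Finset.sum_congr rfl fun P _ => ?_
    rw [soloX_pieces_bank, mul_neg]
  rw [hbank]
  have hcn : max 0 (Real.log 2 - Real.log ‖ξ‖) * (R n).natDegree ≤
      max 0 (Real.log 2 - Real.log ‖ξ‖) * n := mul_le_mul_of_nonneg_left hdeg hc₀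
  linarith

/-- (Bud) ∧ (Srv) packaged for the assembly (F12). -/
theorem soloX_pieces_budget_service {ξ : ℂ} (hξ : Transcendental ℚ ξ) {β σ ν : ℝ}
    {R : ℕ → ℤ[X]} {n₀ : ℕ} (hR : ∀ n, n₀ ≤ n → R n ∈ RoyAdditiveSmall ξ β σ 0 ν n) :
    soloX_pieces ξ R ∈ SoloServiceData.budgetLaw β 2 n₀ ∧
      soloX_pieces ξ R ∈
        SoloServiceData.serviceLaw σ ν (max 0 (Real.log 2 - Real.log ‖ξ‖)) n₀ :=
  ⟨soloX_pieces_budgetLaw hR, soloX_pieces_serviceLaw hξ hR⟩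

end Summit.Schanuel.Schanuel.Theorems
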